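import Summits.CriticalPhenomena.PercolationContinuityZ3.Theorems.PercNearOneGluingNoHeavyQuantHullHigh
import HarnessLib

/-!
# QUANT lane R8, T-DEC: THREE-RELAY SIBLINGS — a closed-form hull + high certificate for every law on `{0,1,2,3}` with mean `> 2`
# (two inequalities C1, C2), and: EVERY CHERRY `R[q](R[p₁] R[p₂])` IS HULL + HIGH DECOMPOSABLE AT EVERY TREE-OK FLOOR

builds on p205010 (kernel theorem, internal audit signed; external expert review pending)

Support file (`--supports stmt-CriticalPhenomena-4575`), QUANT lane seat prim-quant-census-1 (gen 29); memo
`run/shared/lean/prim/quant/prim-quant-census-1/g29/HULLHIGH-G29.md` §5.  Theorems only, standard axioms, no sorries.  Over census-1 g29's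
`…QuantHullHigh` (`IsHigh`, `HullHigh`, `HullHigh.mix`, `hullHigh_of_isHigh`, `hullHigh_of_inBlobHull`).

THE CERTIFICATE (read off the LP vertices of kit j280672, memo §4–§5).  A law `ν` on `{0,1,2,3}` with mean `2 < m < 3` has exactly one positive
low atom, `1`; the atoms `2, 3` are high.  Cover the atom `1` by the two-blob law `Z = blobLaw [(2, g₁), (1, g₂)]` (`2g₁ + g₂ = m`; law
`((1−g₁)(1−g₂), (1−g₁)g₂, g₁(1−g₂), g₁g₂)`), the atom `0` by `Z` and the big blob `A = blobLaw [(3, m/3)]`, and leave the remainder `R = ν − a·A − z·Z`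
on `{2, 3}` — a HIGH law after normalisation (its mean is `m` by bookkeeping, so `R₃(3−m) = R₂(m−2)` and `R ≥ 0 ⟺ R₂ ≥ 0`).  With
`z = ν(1)/(g₂(1−g₁))`, `a = (ν(0) − z(1−g₁)(1−g₂))/(1 − m/3)` the two sign conditions are
  **C1** `ν(1)·(1 − g₂) ≤ ν(0)·g₂`   and   **C2** `ν(1)·g₁·(1 − g₂) ≤ ν(2)·g₂·(1 − g₁)`.
* **`hullHigh_three`** — `x ≤ g₂ ≤ 1`, `x ≤ g₁ = (m − g₂)/2 < 1`, `0 < g₂`, C1, C2 ⟹ `HullHigh x m 3 ν`.  Two useful gates: `g₂ = 1` (C1, C2 vacuous;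
  legal iff `2x ≤ m − 1`: census-1 g28's floor criterion) and `g₂ = m − 2x`, `g₁ = x` (legal iff `2x ≥ m − 1`; then C1, C2 are explicit inequalities
  in `ν(0), ν(1), ν(2), m, x` — the closed form of the hull+high region for three-relay siblings, up to the three-unit-blob columns).
* **`hullHigh_cherry`** — the cherry `R[q](R[p₁] R[p₂])` (root relay with two leaf relays): `ν = (1−q, q(1−p₁)(1−p₂), q(p₁+p₂−2p₁p₂), qp₁p₂)`,
  `m = q(1+p₁+p₂) > 2`, satisfies C1 and C2 with `g₁ = x`, `g₂ = m − 2x` at every floor `x ≤ q·min(p₁,p₂)` with `2x ≥ m − 1` — because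
  `m − 2x ≥ q`, `1 − m + 2x ≤ 1 − q`, `(1−p₁)(1−p₂) ≤ 1` and `p₁(1−p₂) + p₂(1−p₁) ≥ p₁(1−p₂)`;  **`hullHigh_cherry_treeOK`**: hence EVERY cherry with
  `m > 2` is hull+high decomposable at every tree-OK floor (`m ≤ 2`: census-1 g29's `hullHigh_gate_of_meanTwo`), so cherries join 2-chains, mean-`≤ 2`
  siblings and hull members in the oracle-free forests of `sdec_flaw_of_hullHigh` (census: cherries 2 000 / 2 000 at the true floor, kit j280666).
* `HullHigh.mix₃` — a three-term mixture whose components are members WHENEVER THEIR WEIGHT IS POSITIVE is a member (degenerate weights allowed);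
  `blobLaw_two_one_apply` — the law of `[(2,g₁),(1,g₂)]`.

HONEST STATUS.  Sufficient criteria; the 3-chain `R[q](R[p](R[s]))` satisfies C1 always and C2 iff `p(1−s)(m−2x)(1−x) ≥ (1−p)x(1−m+2x)` (fails for a
near-sure leaf under a lighter relay — the glued-child corner; census 3-chains 96.9 %).  `SiblingStep` ⟺ `GateStepN`, `UPartStep`, `LightResidDECOracle`,
`FarTreeRow` OPEN; RATE class (log\*) / honest sentence of `run/shared/lean/prim/quant/README.md` unchanged.  [this work].  Nothing here is cited
as a published result.  The gluing rows served [cite: KozmaNitzan2024, Conjecture 3 (p. 15)]; product measure [cite: Grimmett1999, §1.3 p. 10].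
-/

noncomputable section

open scoped BigOperators

namespace Summit.CriticalPhenomena.PercolationContinuityZ3.Theorems
namespace Quant
namespace LawDec

open Finset

/-! ### Tools: degenerate-friendly three-term mixtures; the law of `[(2,g₁),(1,g₂)]` -/

/-- **two-term mixture, degenerate weights allowed**: `μ = t·μ₁ + (1−t)·μ₂` with `0 ≤ t ≤ 1`, `μ₁` a member if `t > 0`, `μ₂` a member if `t < 1`. [this work] -/
theorem HullHigh.mix₂ {x m t : ℝ} {M : ℕ} {μ μ₁ μ₂ : ℕ → ℝ} (hμ : ∀ h, μ h = t * μ₁ h + (1 - t) * μ₂ h) (ht0 : 0 ≤ t) (ht1 : t ≤ 1)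
    (h₁ : 0 < t → HullHigh x m M μ₁) (h₂ : t < 1 → HullHigh x m M μ₂) : HullHigh x m M μ := by
  by_cases ht : t = 0
  · have e : μ = μ₂ := funext fun h => by rw [hμ h, ht]; ring
    rw [e]; exact h₂ (by rw [ht]; exact zero_lt_one)
  by_cases ht' : t = 1
  · have e : μ = μ₁ := funext fun h => by rw [hμ h, ht']; ring
    rw [e]; exact h₁ (by rw [ht']; exact zero_lt_one)
  have e : μ = fun h => t * μ₁ h + (1 - t) * μ₂ h := funext hμ
  rw [e]
  exact (h₁ (lt_of_le_of_ne ht0 (Ne.symm ht))).mix (h₂ (lt_of_le_of_ne ht1 ht')) ht0 ht1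

/-- **three-term mixture, degenerate weights allowed**: `μ = a·α + b·β + c·γ`, `a, b, c ≥ 0`, `a + b + c = 1`, each component a member whenever its
weight is positive ⟹ `μ` is a member. [this work] -/
theorem HullHigh.mix₃ {x m a b c : ℝ} {M : ℕ} {μ α β γ : ℕ → ℝ} (hμ : ∀ h, μ h = a * α h + b * β h + c * γ h) (ha : 0 ≤ a) (hb : 0 ≤ b)
    (hc : 0 ≤ c) (habc : a + b + c = 1) (hα : 0 < a → HullHigh x m M α) (hβ : 0 < b → HullHigh x m M β) (hγ : 0 < c → HullHigh x m M γ) :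
    HullHigh x m M μ := by
  by_cases hab : a + b = 0
  · have ha0 : a = 0 := by linarith
    have hb0 : b = 0 := by linarith
    have e : μ = γ := funext fun h => by rw [hμ h, ha0, hb0]; rw [ha0, hb0, zero_add, zero_add] at habc; rw [habc]; ring
    rw [e]; exact hγ (by linarith)
  have hab0 : 0 < a + b := lt_of_le_of_ne (by linarith) (Ne.symm hab)
  -- the inner mixture of `α` and `β`
  have inner : HullHigh x m M (fun h => (a / (a + b)) * α h + (1 - a / (a + b)) * β h) := by
    refine HullHigh.mix₂ (fun h => rfl) (div_nonneg ha hab0.le) (by rw [div_le_one hab0]; linarith) (fun hpos => hα ?_) (fun hlt => hβ ?_)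
    · exact lt_of_le_of_ne ha fun e => by rw [← e, zero_div] at hpos; exact lt_irrefl _ hpos
    · rw [div_lt_one hab0] at hlt; linarith
  refine HullHigh.mix₂ (t := a + b) (μ₁ := fun h => (a / (a + b)) * α h + (1 - a / (a + b)) * β h) (μ₂ := γ) (fun h => ?_)
    hab0.le (by linarith) (fun _ => inner) (fun _ => hγ (by linarith))
  rw [hμ h]
  have e : 1 - (a + b) = c := by linarith
  rw [e]
  field_simp
  ring

/-- **the law of the blob list `[(2, g₁), (1, g₂)]`** (an independent double blob and unit blob):
`((1−g₁)(1−g₂), (1−g₁)g₂, g₁(1−g₂), g₁g₂)` on `{0,1,2,3}`. [this work] -/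
theorem blobLaw_two_one_apply (g₁ g₂ : ℝ) (h : ℕ) :
    blobLaw [(2, g₁), (1, g₂)] h = (if h = 0 then (1 - g₁) * (1 - g₂) else 0) + (if h = 1 then (1 - g₁) * g₂ else 0)
      + (if h = 2 then g₁ * (1 - g₂) else 0) + (if h = 3 then g₁ * g₂ else 0) := by
  have inner : ∀ k : ℕ, blobLaw [(1, g₂)] k = (if k = 0 then 1 - g₂ else 0) + (if k = 1 then g₂ else 0) := fun k => blobLaw_single_apply 1 g₂ k
  show slice (blobLaw [(1, g₂)]) 2 g₁ h = _
  simp only [slice, inner]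
  rcases Nat.lt_or_ge h 4 with hlt | hge
  · interval_cases h
    · simp
    · simp
    · simp
    · simp
  · have h0 : h ≠ 0 := by omega
    have h1 : h ≠ 1 := by omega
    have h2 : h ≠ 2 := by omega
    have h3 : h ≠ 3 := by omega
    have h4 : 2 ≤ h := by omega
    have h5 : h - 2 ≠ 0 := by omega
    have h6 : h - 2 ≠ 1 := by omega
    simp [h0, h1, h2, h3, h4, h5, h6]

/-! ### The three-relay certificate -/

set_option maxHeartbeats 400000 in
/-- **THE HULL + HIGH CERTIFICATE FOR LAWS ON `{0,1,2,3}` WITH MEAN `> 2`.**  `ν` a probability law on `{0..3}` with mean `2 < m < 3`; gates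
`0 < g₂`, `x ≤ g₂ ≤ 1`, `x ≤ g₁ := (m − g₂)/2 < 1`; **C1** `ν1·(1−g₂) ≤ ν0·g₂` and **C2** `ν1·g₁·(1−g₂) ≤ ν2·g₂·(1−g₁)` ⟹
`HullHigh x m 3 ν`: `ν = a·blobLaw[(3,m/3)] + z·blobLaw[(2,g₁),(1,g₂)] + w·λ` with `λ` high on `{2,3}`. [this work] -/
theorem hullHigh_three (x m g₂ : ℝ) (ν : ℕ → ℝ) (hν0 : ∀ h, 0 ≤ ν h) (hνM : ∀ h, 3 < h → ν h = 0)
    (hν1 : ∑ h ∈ Finset.range (3 + 1), ν h = 1) (hmean : ∑ h ∈ Finset.range (3 + 1), (h : ℝ) * ν h = m) (hm2 : 2 < m) (hm3 : m < 3)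
    (hxg₂ : x ≤ g₂) (hg₂0 : 0 < g₂) (hg₂1 : g₂ ≤ 1) (hxg₁ : x ≤ (m - g₂) / 2) (hg₁1 : (m - g₂) / 2 < 1)
    (C1 : ν 1 * (1 - g₂) ≤ ν 0 * g₂) (C2 : ν 1 * ((m - g₂) / 2) * (1 - g₂) ≤ ν 2 * g₂ * (1 - (m - g₂) / 2)) : HullHigh x m 3 ν := by
  -- the four atoms
  have hsum : ν 0 + ν 1 + ν 2 + ν 3 = 1 := by simpa [Finset.sum_range_succ] using hν1
  have hmom : ν 1 + 2 * ν 2 + 3 * ν 3 = m := by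
    have := hmean; simp [Finset.sum_range_succ] at this; linarith
  have n1 := hν0 1
  set g₁ : ℝ := (m - g₂) / 2 with hg₁
  have hg₁0 : 0 < g₁ := by rw [hg₁]; linarith
  have hmg : 2 * g₁ + g₂ = m := by rw [hg₁]; ring
  have hx3 : x * (3 : ℝ) ≤ m := by
    rcases le_or_gt g₂ (m / 3) with h | h
    · linarith
    · have : g₁ < m / 3 := by rw [hg₁]; linarith
      linarith
  -- the weights `z` (two-blob component) and `a` (big blob)
  have hden : 0 < g₂ * (1 - g₁) := mul_pos hg₂0 (by linarith)
  set z : ℝ := ν 1 / (g₂ * (1 - g₁)) with hz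
  have hz0 : 0 ≤ z := div_nonneg n1 hden.le
  have hzid : z * (g₂ * (1 - g₁)) = ν 1 := by rw [hz]; exact div_mul_cancel₀ _ hden.ne'
  have hd0 : 0 < 1 - m / 3 := by linarith
  set a : ℝ := (ν 0 - z * ((1 - g₁) * (1 - g₂))) / (1 - m / 3) with ha
  have haid : a * (1 - m / 3) = ν 0 - z * ((1 - g₁) * (1 - g₂)) := by rw [ha]; exact div_mul_cancel₀ _ hd0.ne'
  have ha0 : 0 ≤ a := by
    refine div_nonneg ?_ hd0.le
    have : z * ((1 - g₁) * (1 - g₂)) * g₂ ≤ ν 0 * g₂ := by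
      have e : z * ((1 - g₁) * (1 - g₂)) * g₂ = z * (g₂ * (1 - g₁)) * (1 - g₂) := by ring
      rw [e, hzid]; exact C1
    nlinarith
  -- the remainder on `{2, 3}`
  set R2 : ℝ := ν 2 - z * (g₁ * (1 - g₂)) with hR2def
  set R3 : ℝ := ν 3 - a * (m / 3) - z * (g₁ * g₂) with hR3def
  have hR2 : 0 ≤ R2 := by
    have : z * (g₁ * (1 - g₂)) * (g₂ * (1 - g₁)) ≤ ν 2 * (g₂ * (1 - g₁)) := by
      have e : z * (g₁ * (1 - g₂)) * (g₂ * (1 - g₁)) = z * (g₂ * (1 - g₁)) * g₁ * (1 - g₂) := by ring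
      rw [e, hzid]
      have e2 : ν 2 * (g₂ * (1 - g₁)) = ν 2 * g₂ * (1 - (m - g₂) / 2) := by rw [hg₁]; ring
      rw [e2]; exact C2
    nlinarith
  set w : ℝ := 1 - a - z with hw
  have hwsum : R2 + R3 = w := by
    rw [hR2def, hR3def, hw]; linear_combination hsum + haid + hzid
  have hwmom : 2 * R2 + 3 * R3 = m * w := by
    rw [hR2def, hR3def, hw]; linear_combination hmom + hzid - z * hmg
  have hR3 : 0 ≤ R3 := by
    have : (3 - m) * R3 = (m - 2) * R2 := by linear_combination hwmom - m * hwsum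
    nlinarith
  have hw0 : 0 ≤ w := by linarith
  have k2 : w * (R2 / w) = R2 := by
    by_cases hwz : w = 0
    · have : R2 = 0 := by linarith
      rw [this, hwz]; simp
    · field_simp
  have k3 : w * (R3 / w) = R3 := by
    by_cases hwz : w = 0
    · have : R3 = 0 := by linarith
      rw [this, hwz]; simp
    · field_simp
  -- the three components, atom by atom
  set γ : ℕ → ℝ := fun h => (if h = 2 then R2 / w else 0) + (if h = 3 then R3 / w else 0) with hγ
  have A0 : blobLaw [(3, m / 3)] 0 = 1 - m / 3 := by rw [blobLaw_single_apply]; simp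
  have A1 : blobLaw [(3, m / 3)] 1 = 0 := by rw [blobLaw_single_apply]; simp
  have A2 : blobLaw [(3, m / 3)] 2 = 0 := by rw [blobLaw_single_apply]; simp
  have A3 : blobLaw [(3, m / 3)] 3 = m / 3 := by rw [blobLaw_single_apply]; simp
  have Z0 : blobLaw [(2, g₁), (1, g₂)] 0 = (1 - g₁) * (1 - g₂) := by rw [blobLaw_two_one_apply]; simp
  have Z1 : blobLaw [(2, g₁), (1, g₂)] 1 = (1 - g₁) * g₂ := by rw [blobLaw_two_one_apply]; simp
  have Z2 : blobLaw [(2, g₁), (1, g₂)] 2 = g₁ * (1 - g₂) := by rw [blobLaw_two_one_apply]; simp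
  have Z3 : blobLaw [(2, g₁), (1, g₂)] 3 = g₁ * g₂ := by rw [blobLaw_two_one_apply]; simp
  have G0 : γ 0 = 0 := by simp [hγ]
  have G1 : γ 1 = 0 := by simp [hγ]
  have G2 : γ 2 = R2 / w := by simp [hγ]
  have G3 : γ 3 = R3 / w := by simp [hγ]
  have hA : HullHigh x m 3 (blobLaw [(3, m / 3)]) := by
    have e : blobMean [(3, m / 3)] = m := by simp [blobMean]; ring
    have key := hullHigh_blobLaw x [(3, m / 3)] (fun p hp => by
      rw [List.mem_singleton] at hp; subst hp
      exact ⟨by show x ≤ m / 3; linarith, by show m / 3 ≤ 1; linarith⟩) (M := 3) (by simp [blobTop])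
    rwa [e] at key
  have hZ : HullHigh x m 3 (blobLaw [(2, g₁), (1, g₂)]) := by
    have e : blobMean [(2, g₁), (1, g₂)] = m := by simp [blobMean]; linarith
    have key := hullHigh_blobLaw x [(2, g₁), (1, g₂)] (fun p hp => by
      simp only [List.mem_cons, List.mem_nil_iff, or_false] at hp
      rcases hp with hp | hp <;> subst hp
      · exact ⟨hxg₁, by show g₁ ≤ 1; linarith⟩
      · exact ⟨hxg₂, hg₂1⟩) (M := 3) (by simp [blobTop])
    rwa [e] at key
  have hH : 0 < w → HullHigh x m 3 γ := by
    intro hwpos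
    have hγ4 : ∀ h, 3 < h → γ h = 0 := fun h hh => by simp only [hγ]; rw [if_neg (by omega), if_neg (by omega), add_zero]
    refine hullHigh_of_isHigh ⟨fun h => ?_, hγ4, ?_, ?_, fun h hpos => ?_, by push_cast; linarith⟩
    · have := div_nonneg hR2 hwpos.le; have := div_nonneg hR3 hwpos.le
      simp only [hγ]; split_ifs <;> linarith
    · have hwne := hwpos.ne'
      rw [Finset.sum_range_succ, Finset.sum_range_succ, Finset.sum_range_succ, Finset.sum_range_succ, Finset.sum_range_zero,
        G0, G1, G2, G3]
      field_simp
      linear_combination hwsum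
    · have hwne := hwpos.ne'
      rw [Finset.sum_range_succ, Finset.sum_range_succ, Finset.sum_range_succ, Finset.sum_range_succ, Finset.sum_range_zero,
        G0, G1, G2, G3]
      push_cast
      field_simp
      linear_combination hwmom
    · rcases Nat.lt_or_ge h 4 with hlt | hge
      · interval_cases h
        · rw [G0] at hpos; exact absurd hpos (lt_irrefl 0)
        · rw [G1] at hpos; exact absurd hpos (lt_irrefl 0)
        · push_cast; linarith
        · push_cast; linarith
      · rw [hγ4 h (by omega)] at hpos; exact absurd hpos (lt_irrefl 0)
  -- the mixture identity
  refine HullHigh.mix₃ (a := a) (b := z) (c := w) (α := blobLaw [(3, m / 3)]) (β := blobLaw [(2, g₁), (1, g₂)]) (γ := γ)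
    (fun h => ?_) ha0 hz0 hw0 (by rw [hw]; ring) (fun _ => hA) (fun _ => hZ) hH
  rcases Nat.lt_or_ge h 4 with hlt | hge
  · interval_cases h
    · rw [A0, Z0, G0]; linear_combination (-1 : ℝ) * haid
    · rw [A1, Z1, G1]; linear_combination (-1 : ℝ) * hzid
    · rw [A2, Z2, G2, k2]; linear_combination (-1 : ℝ) * hR2def
    · rw [A3, Z3, G3, k3]; linear_combination (-1 : ℝ) * hR3def
  · rw [hνM h (by omega), blobLaw_eq_zero _ h (by simp [blobTop]; omega), blobLaw_eq_zero _ h (by simp [blobTop]; omega)]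
    simp only [hγ]; rw [if_neg (by omega), if_neg (by omega)]; ring

/-! ### Every cherry -/

/-- the point mass `δ_K` -/
local notation3 "δ[" K "]" => (fun k : ℕ => if k = (K : ℕ) then (1 : ℝ) else 0)

/-- the cherry sub-forest law `δ₁ ∗ gate_{p₁} δ₁ ∗ gate_{p₂} δ₁` (root relay with two leaf relays) -/
local notation3 "CH[" p₁ ", " p₂ "]" => lconv 2 1 (lconv 1 1 δ[1] (gate δ[1] p₁)) (gate δ[1] p₂)

/-- the atoms of the cherry sub-forest law: `(0, (1−p₁)(1−p₂), p₁(1−p₂) + p₂(1−p₁), p₁p₂)`. [this work] -/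
theorem cherry_rho_apply (p₁ p₂ : ℝ) (h : ℕ) :
    (CH[p₁, p₂]) h = (if h = 1 then (1 - p₁) * (1 - p₂) else 0) + (if h = 2 then p₁ * (1 - p₂) + p₂ * (1 - p₁) else 0)
      + (if h = 3 then p₁ * p₂ else 0) := by
  rcases Nat.lt_or_ge h 4 with hlt | hge
  · interval_cases h
    · norm_num [lconv, Finset.sum_range_succ, gate_apply]
    · norm_num [lconv, Finset.sum_range_succ, gate_apply]
    · norm_num [lconv, Finset.sum_range_succ, gate_apply]; ring
    · norm_num [lconv, Finset.sum_range_succ, gate_apply]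
  · rw [if_neg (by omega), if_neg (by omega), if_neg (by omega), add_zero, add_zero]
    simp only [lconv, gate_apply]
    refine Finset.sum_eq_zero fun i hi => Finset.sum_eq_zero fun k hk => ?_
    rw [Finset.mem_range] at hi hk
    rw [if_neg (by omega)]

/-- **EVERY CHERRY WITH MEAN `> 2` IS HULL + HIGH DECOMPOSABLE** at every floor `x ≤ q·min(p₁,p₂)` with `2x ≥ m − 1` (`m = q(1+p₁+p₂)`): the gated
cherry `gate_q(δ₁ ∗ gate_{p₁}δ₁ ∗ gate_{p₂}δ₁) = (1−q, q(1−p₁)(1−p₂), q(p₁(1−p₂)+p₂(1−p₁)), qp₁p₂)` satisfies C1 and C2 with `g₁ = x`,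
`g₂ = m − 2x` (`m − 2x ≥ q`, `1 − m + 2x ≤ 1 − q`, `(1−p₁)(1−q) ≤ 1 − x`). [this work] -/
theorem hullHigh_cherry {q p₁ p₂ x : ℝ} (hq0 : 0 < q) (hq1 : q < 1) (hp₁0 : 0 ≤ p₁) (hp₁1 : p₁ ≤ 1) (hp₂0 : 0 ≤ p₂) (hp₂1 : p₂ ≤ 1)
    (hm2 : 2 < q * (1 + p₁ + p₂)) (hx₁ : x ≤ q * p₁) (hx₂ : x ≤ q * p₂) (hxm : q * (1 + p₁ + p₂) - 1 ≤ 2 * x) :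
    HullHigh x (q * (1 + p₁ + p₂)) 3 (gate (CH[p₁, p₂]) q) := by
  set m : ℝ := q * (1 + p₁ + p₂) with hm
  have app : ∀ h : ℕ, gate (CH[p₁, p₂]) q h = q * ((if h = 1 then (1 - p₁) * (1 - p₂) else 0)
      + (if h = 2 then p₁ * (1 - p₂) + p₂ * (1 - p₁) else 0) + (if h = 3 then p₁ * p₂ else 0)) + (1 - q) * (if h = 0 then 1 else 0) := by
    intro h; rw [gate_apply, cherry_rho_apply]
  have v0 : gate (CH[p₁, p₂]) q 0 = 1 - q := by rw [app]; simp
  have v1 : gate (CH[p₁, p₂]) q 1 = q * ((1 - p₁) * (1 - p₂)) := by rw [app]; simp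
  have v2 : gate (CH[p₁, p₂]) q 2 = q * (p₁ * (1 - p₂) + p₂ * (1 - p₁)) := by rw [app]; simp
  have v3 : gate (CH[p₁, p₂]) q 3 = q * (p₁ * p₂) := by rw [app]; simp
  have v4 : ∀ h, 3 < h → gate (CH[p₁, p₂]) q h = 0 := fun h hh => by
    rw [app, if_neg (by omega), if_neg (by omega), if_neg (by omega), if_neg (by omega)]; ring
  have hm3 : m < 3 := by rw [hm]; nlinarith
  have hqx : q ≤ m - 2 * x := by rw [hm]; nlinarith
  have hx1 : x < 1 := by nlinarith
  have hxq : x ≤ q := by nlinarith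
  have e1 : (m - (m - 2 * x)) / 2 = x := by ring
  refine hullHigh_three x m (m - 2 * x) _ (fun h => ?_) v4 ?_ ?_ hm2 hm3 (by linarith) (by linarith) (by linarith)
    (by rw [e1]) (by rw [e1]; exact hx1) ?_ ?_
  · rcases Nat.lt_or_ge h 4 with hlt | hge
    · interval_cases h
      · rw [v0]; linarith
      · rw [v1]; positivity
      · rw [v2]; nlinarith [mul_nonneg hp₁0 (sub_nonneg.2 hp₂1), mul_nonneg hp₂0 (sub_nonneg.2 hp₁1)]
      · rw [v3]; positivity
    · rw [v4 h (by omega)]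
  · rw [Finset.sum_range_succ, Finset.sum_range_succ, Finset.sum_range_succ, Finset.sum_range_succ, Finset.sum_range_zero, v0, v1, v2, v3]
    ring
  · rw [Finset.sum_range_succ, Finset.sum_range_succ, Finset.sum_range_succ, Finset.sum_range_succ, Finset.sum_range_zero, v0, v1, v2, v3]
    push_cast; rw [hm]; ring
  · -- C1
    rw [v1, v0]
    have hA : q * ((1 - p₁) * (1 - p₂)) * (1 - (m - 2 * x)) ≤ q * 1 * (1 - q) := by
      have : 1 - (m - 2 * x) ≤ 1 - q := by linarith
      have : 0 ≤ 1 - (m - 2 * x) := by linarith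
      have : (1 - p₁) * (1 - p₂) ≤ 1 := by nlinarith
      gcongr
    have hB : q * 1 * (1 - q) ≤ (1 - q) * (m - 2 * x) := by nlinarith
    linarith
  · -- C2
    rw [v1, v2, e1]
    have hL : q * ((1 - p₁) * (1 - p₂)) * x * (1 - (m - 2 * x)) ≤ q * ((1 - p₁) * (1 - p₂)) * (q * p₁) * (1 - q) := by
      have : 1 - (m - 2 * x) ≤ 1 - q := by linarith
      have : 0 ≤ 1 - (m - 2 * x) := by linarith
      gcongr
    have hM : q * ((1 - p₁) * (1 - p₂)) * (q * p₁) * (1 - q) ≤ q * (p₁ * (1 - p₂)) * q * (1 - x) := by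
      have k : (1 - p₁) * (1 - q) ≤ 1 - x := by nlinarith
      have e : q * ((1 - p₁) * (1 - p₂)) * (q * p₁) * (1 - q) = (q * (p₁ * (1 - p₂)) * q) * ((1 - p₁) * (1 - q)) := by ring
      rw [e]
      exact mul_le_mul_of_nonneg_left k (by positivity)
    have hR : q * (p₁ * (1 - p₂)) * q * (1 - x) ≤ q * (p₁ * (1 - p₂) + p₂ * (1 - p₁)) * (m - 2 * x) * (1 - x) := by
      have : p₁ * (1 - p₂) ≤ p₁ * (1 - p₂) + p₂ * (1 - p₁) := by nlinarith
      have : 0 ≤ 1 - x := by linarith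
      gcongr
    linarith

/-- **EVERY TREE-OK CHERRY WITH MEAN `> 2` IS HULL + HIGH DECOMPOSABLE AT ITS FLOOR** — either `2x ≤ m − 1` (gate `g₂ = 1`: C1, C2 vacuous) or
`2x ≥ m − 1` (`hullHigh_cherry`).  With `hullHigh_gate_of_meanTwo` (`m ≤ 2`, `…QuantNoLowSiblings`) every cherry joins the oracle-free forests of
`sdec_flaw_of_hullHigh`. [this work] -/
theorem hullHigh_cherry_of_floor {q p₁ p₂ x : ℝ} (hq0 : 0 < q) (hq1 : q < 1) (hp₁0 : 0 ≤ p₁) (hp₁1 : p₁ ≤ 1) (hp₂0 : 0 ≤ p₂) (hp₂1 : p₂ ≤ 1)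
    (hm2 : 2 < q * (1 + p₁ + p₂)) (hx₁ : x ≤ q * p₁) (hx₂ : x ≤ q * p₂) :
    HullHigh x (q * (1 + p₁ + p₂)) 3 (gate (CH[p₁, p₂]) q) := by
  rcases le_or_gt (q * (1 + p₁ + p₂) - 1) (2 * x) with hhi | hlo
  · exact hullHigh_cherry hq0 hq1 hp₁0 hp₁1 hp₂0 hp₂1 hm2 hx₁ hx₂ hhi
  · -- low floor: `g₂ = 1`, `g₁ = (m−1)/2 ≥ x`
    set m : ℝ := q * (1 + p₁ + p₂) with hm
    have app : ∀ h : ℕ, gate (CH[p₁, p₂]) q h = q * ((if h = 1 then (1 - p₁) * (1 - p₂) else 0)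
        + (if h = 2 then p₁ * (1 - p₂) + p₂ * (1 - p₁) else 0) + (if h = 3 then p₁ * p₂ else 0)) + (1 - q) * (if h = 0 then 1 else 0) := by
      intro h; rw [gate_apply, cherry_rho_apply]
    have v0 : gate (CH[p₁, p₂]) q 0 = 1 - q := by rw [app]; simp
    have v1 : gate (CH[p₁, p₂]) q 1 = q * ((1 - p₁) * (1 - p₂)) := by rw [app]; simp
    have v2 : gate (CH[p₁, p₂]) q 2 = q * (p₁ * (1 - p₂) + p₂ * (1 - p₁)) := by rw [app]; simp
    have v3 : gate (CH[p₁, p₂]) q 3 = q * (p₁ * p₂) := by rw [app]; simp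
    have v4 : ∀ h, 3 < h → gate (CH[p₁, p₂]) q h = 0 := fun h hh => by
      rw [app, if_neg (by omega), if_neg (by omega), if_neg (by omega), if_neg (by omega)]; ring
    have hm3 : m < 3 := by rw [hm]; nlinarith
    have C1' : gate (CH[p₁, p₂]) q 1 * (1 - 1) ≤ gate (CH[p₁, p₂]) q 0 * 1 := by rw [sub_self, mul_zero, mul_one, v0]; linarith
    have C2' : gate (CH[p₁, p₂]) q 1 * ((m - 1) / 2) * (1 - 1) ≤ gate (CH[p₁, p₂]) q 2 * 1 * (1 - (m - 1) / 2) := by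
      rw [sub_self, mul_zero, mul_one, v2]
      have : 0 ≤ 1 - (m - 1) / 2 := by linarith
      have : 0 ≤ q * (p₁ * (1 - p₂) + p₂ * (1 - p₁)) := by nlinarith [mul_nonneg hp₁0 (sub_nonneg.2 hp₂1), mul_nonneg hp₂0 (sub_nonneg.2 hp₁1)]
      positivity
    refine hullHigh_three x m 1 _ (fun h => ?_) v4 ?_ ?_ hm2 hm3 (by linarith) zero_lt_one le_rfl (by linarith) (by linarith) C1' C2'
    · rcases Nat.lt_or_ge h 4 with hlt | hge
      · interval_cases h
        · rw [v0]; linarith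
        · rw [v1]; positivity
        · rw [v2]; nlinarith [mul_nonneg hp₁0 (sub_nonneg.2 hp₂1), mul_nonneg hp₂0 (sub_nonneg.2 hp₁1)]
        · rw [v3]; positivity
      · rw [v4 h (by omega)]
    · rw [Finset.sum_range_succ, Finset.sum_range_succ, Finset.sum_range_succ, Finset.sum_range_succ, Finset.sum_range_zero, v0, v1, v2, v3]
      ring
    · rw [Finset.sum_range_succ, Finset.sum_range_succ, Finset.sum_range_succ, Finset.sum_range_succ, Finset.sum_range_zero, v0, v1, v2, v3]
      push_cast; rw [hm]; ring

end LawDec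
end Quant
end Summit.CriticalPhenomena.PercolationContinuityZ3.Theorems
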